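import Mathlib.Analysis.Calculus.ParametricIntegral
import Mathlib.MeasureTheory.Integral.Bochner.Set
import Mathlib.MeasureTheory.Function.LocallyIntegrable
import HarnessLib

/-!
# Parametric integrals against a compactly supported continuous weight

Analysis/FluidPDE support file (general calculus layer) for the proof of the named fact
`Literature.Analysis.FluidPDE.KNSS2009_lemma21` (KNSS 2009, Lemma 2.1 as printed). The barriers
of that proof are the functions `Ψ(p) = ∫ h(z) F(p, z) dz`, where the weight `h` is continuous
with compact support (a cut-off times a time slice of the solution) and the kernel `F` is
smooth in the parameter `p` (a space point or a time). For such integrals every domination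
hypothesis of the parametric-integration theorems of Mathlib is automatic — on
`(compact neighbourhood of p₀) × tsupport h` a continuous `∂ₚF` is bounded — and this file
records the resulting clean statements:

* `continuousOn_integral_smul_of_continuousOn`: `p ↦ ∫ h z • F p z` is continuous on `U` if
  `F` is jointly continuous on `U × univ` (Mathlib's `continuousOn_integral_of_compact_support`);
* `hasFDerivAt_integral_smul_of_continuousOn`: if moreover `F(·, z)` has a Fréchet derivative
  `F'(p, z)` for `p ∈ U` (`U` open in a proper normed space) with `F'` jointly continuous, then
  `p ↦ ∫ h z • F p z` has derivative `∫ h z • F' p₀ z` at `p₀ ∈ U`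
  (`hasFDerivAt_integral_of_dominated_of_fderiv_le`);
* `hasDerivAt_integral_smul_of_continuousOn`: the same for a real parameter and `HasDerivAt`.

## References

* [folklore] (differentiation under the integral sign; e.g. Mathlib
  `Mathlib.Analysis.Calculus.ParametricIntegral`).
-/

noncomputable section

open MeasureTheory Set Function Filter TopologicalSpace Metric
open scoped Topology

namespace Literature.Analysis.FluidPDE

variable {X : Type*} {α : Type*} [TopologicalSpace α] [MeasurableSpace α] [OpensMeasurableSpace α]
  {μ : Measure α} {G : Type*} [NormedAddCommGroup G] [NormedSpace ℝ G]

/-- **Continuity of a parametric integral against a compactly supported continuous weight**: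
if `h` is continuous with compact support and `F` is jointly continuous on `U × univ`, then
`p ↦ ∫ h z • F p z ∂μ` is continuous on `U` (for a measure finite on compact sets).
[folklore] -/
theorem continuousOn_integral_smul_of_continuousOn [TopologicalSpace X]
    [IsFiniteMeasureOnCompacts μ] {h : α → ℝ} (hh : Continuous h) (hhs : HasCompactSupport h)
    {F : X → α → G} {U : Set X} (hF : ContinuousOn (uncurry F) (U ×ˢ univ)) :
    ContinuousOn (fun p => ∫ z, h z • F p z ∂μ) U := by
  refine continuousOn_integral_of_compact_support (k := tsupport h) hhs ?_ ?_
  · exact ((hh.comp continuous_snd).continuousOn).smul hF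
  · intro p z _ hz
    simp [image_eq_zero_of_notMem_tsupport hz]

variable [NormedAddCommGroup X] [NormedSpace ℝ X] [ProperSpace X]
  [SecondCountableTopology α] [IsFiniteMeasureOnCompacts μ]

omit [MeasurableSpace α] [OpensMeasurableSpace α] [NormedSpace ℝ X] [SecondCountableTopology α]
  [IsFiniteMeasureOnCompacts μ] in
/-- A continuous function on `U × univ` is bounded on `closedBall p₀ r × K` for `K` compact and
`closedBall p₀ r ⊆ U` (proper parameter space). [folklore] -/
theorem exists_bound_on_closedBall_prod {Y : Type*} [NormedAddCommGroup Y] {F' : X → α → Y}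
    {U : Set X} (hF' : ContinuousOn (uncurry F') (U ×ˢ univ)) {p₀ : X} {r : ℝ}
    (hr : closedBall p₀ r ⊆ U) {K : Set α} (hK : IsCompact K) :
    ∃ C : ℝ, 0 ≤ C ∧ ∀ p ∈ closedBall p₀ r, ∀ z ∈ K, ‖F' p z‖ ≤ C := by
  have hc : IsCompact (closedBall p₀ r ×ˢ K) := (isCompact_closedBall p₀ r).prod hK
  obtain ⟨C, hC⟩ := hc.exists_bound_of_continuousOn
    (hF'.mono (prod_mono hr (subset_univ _)))
  refine ⟨max C 0, le_max_right _ _, fun p hp z hz => ?_⟩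
  exact (hC (p, z) ⟨hp, hz⟩).trans (le_max_left _ _)

/-- **Differentiation under the integral sign against a compactly supported continuous
weight.** Let `h` be continuous with compact support, `U` open in a proper real normed space,
`F` jointly continuous on `U × univ` with `HasFDerivAt (F · z) (F' p z) p` for `p ∈ U` and `F'`
jointly continuous on `U × univ`. Then at every `p₀ ∈ U`,
`HasFDerivAt (fun p => ∫ h z • F p z ∂μ) (∫ h z • F' p₀ z ∂μ) p₀`. (All domination hypotheses of
`hasFDerivAt_integral_of_dominated_of_fderiv_le` hold with the bound `C ‖h z‖`, `C` a bound of
`F'` on `closedBall p₀ r × tsupport h`.) [folklore] -/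
theorem hasFDerivAt_integral_smul_of_continuousOn {h : α → ℝ} (hh : Continuous h)
    (hhs : HasCompactSupport h) {F : X → α → G} {F' : X → α → (X →L[ℝ] G)} {U : Set X}
    (hU : IsOpen U) (hF : ContinuousOn (uncurry F) (U ×ˢ univ))
    (hF' : ContinuousOn (uncurry F') (U ×ˢ univ))
    (hderiv : ∀ p ∈ U, ∀ z, HasFDerivAt (F · z) (F' p z) p) {p₀ : X} (hp₀ : p₀ ∈ U) :
    HasFDerivAt (fun p => ∫ z, h z • F p z ∂μ) (∫ z, h z • F' p₀ z ∂μ) p₀ := by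
  -- a closed ball inside `U` and a bound for `F'` on `closedBall p₀ r × tsupport h`
  obtain ⟨r₀, hr₀, hr₀U⟩ := Metric.isOpen_iff.1 hU p₀ hp₀
  set r : ℝ := r₀ / 2 with hr
  have hrpos : 0 < r := by rw [hr]; linarith
  have hcbU : closedBall p₀ r ⊆ U := (closedBall_subset_ball (by rw [hr]; linarith)).trans hr₀U
  have hbU : ball p₀ r ⊆ U := ball_subset_closedBall.trans hcbU
  obtain ⟨C, hC0, hC⟩ := exists_bound_on_closedBall_prod hF' hcbU hhs.isCompact
  -- continuity of the slices
  have hFc : ∀ p ∈ U, Continuous (F p) := fun p hp =>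
    hF.comp_continuous (Continuous.prodMk_right p) fun z => ⟨hp, mem_univ _⟩
  have hF'c : ∀ p ∈ U, Continuous (F' p) := fun p hp =>
    hF'.comp_continuous (Continuous.prodMk_right p) fun z => ⟨hp, mem_univ _⟩
  refine hasFDerivAt_integral_of_dominated_of_fderiv_le (𝕜 := ℝ) (μ := μ)
    (F := fun p z => h z • F p z) (F' := fun p z => h z • F' p z) (bound := fun z => C * ‖h z‖)
    (ball_mem_nhds p₀ hrpos) ?_ ?_ ?_ ?_ ?_ ?_
  · filter_upwards [hU.mem_nhds hp₀] with p hp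
    exact (hh.smul (hFc p hp)).aestronglyMeasurable
  · have hcs : HasCompactSupport fun z => h z • F p₀ z := hhs.smul_right (f' := F p₀)
    exact (hh.smul (hFc p₀ hp₀)).integrable_of_hasCompactSupport hcs
  · exact (hh.smul (hF'c p₀ hp₀)).aestronglyMeasurable
  · refine Eventually.of_forall fun z p hp => ?_
    rw [norm_smul, mul_comm]
    by_cases hz : z ∈ tsupport h
    · exact mul_le_mul_of_nonneg_right (hC p (ball_subset_closedBall hp) z hz) (norm_nonneg _)
    · simp [image_eq_zero_of_notMem_tsupport hz]
  · exact (hh.norm.const_mul C).integrable_of_hasCompactSupport (hhs.norm.mul_left)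
  · exact Eventually.of_forall fun z p hp => (hderiv p (hbU hp) z).const_smul (h z)

/-- **Differentiation under the integral sign, real parameter**: as
`hasFDerivAt_integral_smul_of_continuousOn` with `HasDerivAt` in a real parameter. [folklore] -/
theorem hasDerivAt_integral_smul_of_continuousOn {h : α → ℝ} (hh : Continuous h)
    (hhs : HasCompactSupport h) {F : ℝ → α → G} {F' : ℝ → α → G} {U : Set ℝ}
    (hU : IsOpen U) (hF : ContinuousOn (uncurry F) (U ×ˢ univ))
    (hF' : ContinuousOn (uncurry F') (U ×ˢ univ))
    (hderiv : ∀ t ∈ U, ∀ z, HasDerivAt (F · z) (F' t z) t) {t₀ : ℝ} (ht₀ : t₀ ∈ U) :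
    HasDerivAt (fun t => ∫ z, h z • F t z ∂μ) (∫ z, h z • F' t₀ z ∂μ) t₀ := by
  obtain ⟨r₀, hr₀, hr₀U⟩ := Metric.isOpen_iff.1 hU t₀ ht₀
  set r : ℝ := r₀ / 2 with hr
  have hrpos : 0 < r := by rw [hr]; linarith
  have hcbU : closedBall t₀ r ⊆ U := (closedBall_subset_ball (by rw [hr]; linarith)).trans hr₀U
  have hbU : ball t₀ r ⊆ U := ball_subset_closedBall.trans hcbU
  obtain ⟨C, hC0, hC⟩ := exists_bound_on_closedBall_prod hF' hcbU hhs.isCompact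
  have hFc : ∀ t ∈ U, Continuous (F t) := fun t ht =>
    hF.comp_continuous (Continuous.prodMk_right t) fun z => ⟨ht, mem_univ _⟩
  have hF'c : ∀ t ∈ U, Continuous (F' t) := fun t ht =>
    hF'.comp_continuous (Continuous.prodMk_right t) fun z => ⟨ht, mem_univ _⟩
  refine (hasDerivAt_integral_of_dominated_loc_of_deriv_le (𝕜 := ℝ) (μ := μ)
    (F := fun t z => h z • F t z) (F' := fun t z => h z • F' t z) (bound := fun z => C * ‖h z‖)
    (ball_mem_nhds t₀ hrpos) ?_ ?_ ?_ ?_ ?_ ?_).2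
  · filter_upwards [hU.mem_nhds ht₀] with t ht
    exact (hh.smul (hFc t ht)).aestronglyMeasurable
  · have hcs : HasCompactSupport fun z => h z • F t₀ z := hhs.smul_right (f' := F t₀)
    exact (hh.smul (hFc t₀ ht₀)).integrable_of_hasCompactSupport hcs
  · exact (hh.smul (hF'c t₀ ht₀)).aestronglyMeasurable
  · refine Eventually.of_forall fun z t ht => ?_
    rw [norm_smul, mul_comm]
    by_cases hz : z ∈ tsupport h
    · exact mul_le_mul_of_nonneg_right (hC t (ball_subset_closedBall ht) z hz) (norm_nonneg _)
    · simp [image_eq_zero_of_notMem_tsupport hz]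
  · exact (hh.norm.const_mul C).integrable_of_hasCompactSupport (hhs.norm.mul_left)
  · exact Eventually.of_forall fun z t ht => (hderiv t (hbU ht) z).const_smul (h z)

end Literature.Analysis.FluidPDE

end
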